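import Literature.AlgebraicGeometry.Modules.AffineLocalizingClosure
import Literature.AlgebraicGeometry.Modules.IsoOfSectionsOnBasis
import Literature.AlgebraicGeometry.Modules.SectionsExact
import HarnessLib

/-!
# An affine-localizing module with no sections on an affine cover is zero; monomorphisms tested on a cover

For an affine-localizing (`Modules/AffineLocalizing`; e.g. quasi-coherent) `𝒪_X`-module `M` and an
affine open cover `(V_i)` of `X`:

* `IsAffineLocalizing.app_eq_zero_of_cover` — if `Γ(V_i, M) = 0` for all `i`, then `Γ(W, M) = 0` for
  EVERY open `W` (over the basic opens `D(g) ⊆ V_i` a section is a fraction of a section over `V_i`,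
  by the numerator property; these basic opens form a basis); hence `M` is a zero object
  (`isZero_of_cover`);
* `mono_of_app_injective_of_cover` — a morphism `φ : M → N` of affine-localizing modules which is
  injective on the sections over the `V_i` is a MONOMORPHISM (its kernel is affine-localizing with no
  sections on the cover);

This is how injectivity statements proved by commutative algebra over the rings `Γ(V_i, 𝒪_X)` of a
FINITE affine cover (where uniform constants, e.g. Artin–Rees exponents, are available) are turned
into statements about sheaves (Hartshorne II Prop. 5.4/5.6: on an affine scheme quasi-coherent
modules are determined by global sections). Everything is proved; no named facts.

## References

* R. Hartshorne, *Algebraic Geometry*, GTM 52 (1977), II Lemma 5.3, Cor. 5.5 (pp. 112–113).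
  [Hartshorne1977]
* The Stacks Project, Tag 01I7 (quasi-coherent modules on affines). [StacksProject]
-/

noncomputable section

open CategoryTheory AlgebraicGeometry Limits TopologicalSpace Opposite

universe u

namespace Literature.AlgebraicGeometry.Modules

variable {X : Scheme.{u}} {M N : X.Modules}

/-- The basic opens of the members of an open affine cover form a basis of `X`. [folklore] -/
theorem isBasis_basicOpen_of_cover {ι : Type*} (V : ι → X.Opens) (hV : ∀ i, IsAffineOpen (V i))
    (hcov : ⨆ i, V i = ⊤) :
    Opens.IsBasis {W : X.Opens | ∃ (i : ι) (g : Γ(X, V i)), W = X.basicOpen g} := by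
  refine Opens.isBasis_iff_nbhd.mpr fun {U x} hx => ?_
  have hxi : x ∈ (⨆ i, V i : X.Opens) := by rw [hcov]; trivial
  obtain ⟨i, hi⟩ := Opens.mem_iSup.mp hxi
  obtain ⟨g, hgU, hxg⟩ := (hV i).exists_basicOpen_le ⟨x, hx⟩ hi
  exact ⟨X.basicOpen g, ⟨i, g, rfl⟩, hxg, hgU⟩

/-- **An affine-localizing module with no sections over the members of an affine open cover has
no sections at all.** [cite: Hartshorne1977, II Lemma 5.3 and Cor. 5.5 (pp. 112–113)] -/
theorem IsAffineLocalizing.app_eq_zero_of_cover (hM : IsAffineLocalizing M) {ι : Type*}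
    (V : ι → X.Opens) (hV : ∀ i, IsAffineOpen (V i)) (hcov : ⨆ i, V i = ⊤)
    (h0 : ∀ i (x : Γ(M, V i)), x = 0) (W : X.Opens) (y : Γ(M, W)) : y = 0 := by
  refine eq_zero_of_map_eq_zero_on_basis (isBasis_basicOpen_of_cover V hV hcov) y ?_
  rintro _ ⟨i, g, rfl⟩ hgW
  -- on `D(g) ⊆ V_i`, `y|` is `x| / gⁿ` with `x ∈ Γ(V_i, M) = 0`
  set y' := M.presheaf.map (homOfLE hgW).op y
  obtain ⟨n, x, hx⟩ := hM.numerator (hV i) g rfl y'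
  rw [h0 i x, map_zero] at hx
  have hu : IsUnit (X.presheaf.map (homOfLE ((rfl : X.basicOpen g = X.basicOpen g).trans_le
      (X.basicOpen_le g))).op g ^ n) :=
    (RingedSpace.isUnit_res_basicOpen (X := X.toRingedSpace) g).pow n
  obtain ⟨v, hv⟩ := hu
  have : (↑v⁻¹ : Γ(X, X.basicOpen g)) • ((↑v : Γ(X, X.basicOpen g)) • y') = 0 := by
    rw [hv, ← hx, smul_zero]
  rwa [smul_smul, Units.inv_mul, one_smul] at this

/-- **An affine-localizing module with no sections over an affine open cover is zero.**
[cite: Hartshorne1977, II Cor. 5.5 (p. 113)] -/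
theorem IsAffineLocalizing.isZero_of_cover (hM : IsAffineLocalizing M) {ι : Type*}
    (V : ι → X.Opens) (hV : ∀ i, IsAffineOpen (V i)) (hcov : ⨆ i, V i = ⊤)
    (h0 : ∀ i (x : Γ(M, V i)), x = 0) : IsZero M := by
  rw [IsZero.iff_id_eq_zero]
  refine Scheme.Modules.hom_ext _ _ fun W => ?_
  ext y
  rw [hM.app_eq_zero_of_cover V hV hcov h0 W y, map_zero, map_zero]

/-- **Monomorphisms are detected on an affine open cover**: a morphism of affine-localizing modules
injective on the sections over the members of an affine open cover is a monomorphism (its kernel is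
affine-localizing, with no sections over the cover). [cite: Hartshorne1977, II Prop. 5.6 (p. 113)] -/
theorem mono_of_app_injective_of_cover (φ : M ⟶ N) (hM : IsAffineLocalizing M)
    (hN : IsAffineLocalizing N) {ι : Type*} (V : ι → X.Opens) (hV : ∀ i, IsAffineOpen (V i))
    (hcov : ⨆ i, V i = ⊤) (hinj : ∀ i, Function.Injective (φ.app (V i))) : Mono φ := by
  have hK : IsZero (kernel φ) := by
    refine (IsAffineLocalizing.kernel φ hM hN).isZero_of_cover V hV hcov fun i x => ?_
    apply kernel_ι_app_injective φ (V i)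
    rw [map_zero]
    apply hinj i
    rw [map_zero, app_kernel_ι_app]
  exact Preadditive.mono_of_isZero_kernel' _ (kernelIsKernel φ) hK

end Literature.AlgebraicGeometry.Modules

end
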